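import Summits.Ventures.LatticeQCDFlow.Exactness.FlowSamplerGroupSymmetrisation
import Mathlib.Analysis.SpecialFunctions.Log.NegMulLog
import Mathlib.Analysis.Convex.SpecificFunctions.Basic
import HarnessLib

/-!
# AVERAGING A FLOW OVER A FINITE FAMILY OF SYMMETRIES NEVER INCREASES EITHER KL DIVERGENCE NOR DECREASES THE OVERLAP

HONEST FRAMING: exact (Metropolis-corrected) sampling algorithms for lattice gauge theory;
figures of merit are autocorrelation/cost numbers at stated couplings and volumes; no
continuum-physics claim.  (SCALAR calibration rung S0-A: not a gauge result.)

Venture `LatticeQCDFlow` (cell pub-lqcd), topic `Exactness`; FANOUT row 2 (`s0-phi4`, FLOW arm).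
NEW WORK of the cell, the finite-family companion of `FlowSamplerSymmetrisationKL` (there `Z₂`):
`t : ι → (X ≃ᵐ X)` a finite nonempty family of measure-preserving symmetries of the target weight
(`w ∘ t_i = w`), `q̃ > 0` a model density, `q̄ = N⁻¹ Σ_i q̃ ∘ t_i` the averaged proposal
(`FlowSamplerGroupSymmetrisation`; the 'single-model symmetrized mixture' of Boyda et al. 2021 /
Hackett et al. 2021 §4.2, NAMED).  `N`-point Jensen for `x ↦ x log x` (`Real.convexOn_mul_log`) and for
`log` (`strictConcaveOn_log_Ioi`), the superadditivity of `min`, and `∫ F ∘ t_i = ∫ F` give: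

* `avg_mul_log_div_le`, `avg_log_le_log_avg` — the two pointwise Jensen steps;
* **`groupAvg_reverseKL_le`** — `q̃ log(q̃/w) ∈ L¹ ⇒ q̄ log(q̄/w) ∈ L¹` and `∫ q̄ log(q̄/w) ≤ ∫ q̃ log(q̃/w)`
  (the flow's self-sampling TRAINING LOSS, up to `log Z`, never increases under averaging);
* **`groupAvg_forwardKL_le`** — `w log(w/q̃) ∈ L¹ ⇒ ∫ w log(w/q̄) ≤ ∫ w log(w/q̃)` (coverage loss);
* **`groupAvg_overlap_ge`** — `∫ min(w, q̄) ≥ ∫ min(w, q̃)`: the total-variation distance to the target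
  never increases (so `FlowAcceptanceOverlap`'s `m² ≤ ā ≤ m` certificates never degrade).

NOT CLAIMED: strictness; any value for any network; cost (`N` density evaluations per proposal);
anything about training dynamics of equivariant architectures.  Classical convexity of relative
entropy (log-sum inequality) NAMED, not cited.
-/

namespace Summit.Ventures.LatticeQCDFlow.Exactness

open Real MeasureTheory Filter Finset Set Topology
open Summit.Ventures.LatticeQCDFlow.Scoring

/-! ## §0 Two `N`-point Jensen steps -/

/-- `N`-point convexity of `a ↦ a log(a/b)`: for `a_i, b > 0`,
`(N⁻¹Σ a_i) log((N⁻¹Σ a_i)/b) ≤ N⁻¹ Σ a_i log(a_i/b)`. -/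
theorem avg_mul_log_div_le {ι : Type*} [Fintype ι] [Nonempty ι] {a : ι → ℝ} {b : ℝ}
    (ha : ∀ i, 0 < a i) (hb : 0 < b) :
    (∑ i, a i) / Fintype.card ι * Real.log ((∑ i, a i) / Fintype.card ι / b)
      ≤ (∑ i, a i * Real.log (a i / b)) / Fintype.card ι := by
  have hN : (0 : ℝ) < Fintype.card ι := by exact_mod_cast Fintype.card_pos
  -- Jensen for `ψ(x) = x log x` at the points `a_i / b` with weights `1/N`
  have h := Real.convexOn_mul_log.map_sum_le (t := Finset.univ)
    (w := fun _ => 1 / (Fintype.card ι : ℝ)) (p := fun i => a i / b)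
    (fun i _ => (div_pos one_pos hN).le)
    (by rw [Finset.sum_const, Finset.card_univ, nsmul_eq_mul]; field_simp)
    (fun i _ => Set.mem_Ici.2 (div_pos (ha i) hb).le)
  simp only [smul_eq_mul] at h
  have e1 : ∑ i, 1 / (Fintype.card ι : ℝ) * (a i / b) = (∑ i, a i) / Fintype.card ι / b := by
    rw [← Finset.mul_sum, ← Finset.sum_div]; ring
  rw [e1] at h
  -- multiply by `b > 0`
  have e2 : (∑ i, a i) / Fintype.card ι * Real.log ((∑ i, a i) / Fintype.card ι / b)
      = b * ((∑ i, a i) / Fintype.card ι / b * Real.log ((∑ i, a i) / Fintype.card ι / b)) := by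
    field_simp
  have e3 : (∑ i, a i * Real.log (a i / b)) / Fintype.card ι
      = b * ∑ i, 1 / (Fintype.card ι : ℝ) * (a i / b * Real.log (a i / b)) := by
    rw [← Finset.mul_sum, Finset.mul_sum, Finset.mul_sum, Finset.sum_div]
    refine Finset.sum_congr rfl fun i _ => ?_
    field_simp
  rw [e2, e3]
  exact mul_le_mul_of_nonneg_left h hb.le

/-- `N`-point concavity of `log`: `N⁻¹ Σ log a_i ≤ log(N⁻¹ Σ a_i)` for `a_i > 0`. -/
theorem avg_log_le_log_avg {ι : Type*} [Fintype ι] [Nonempty ι] {a : ι → ℝ} (ha : ∀ i, 0 < a i) :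
    (∑ i, Real.log (a i)) / Fintype.card ι ≤ Real.log ((∑ i, a i) / Fintype.card ι) := by
  have hN : (0 : ℝ) < Fintype.card ι := by exact_mod_cast Fintype.card_pos
  have h := strictConcaveOn_log_Ioi.concaveOn.le_map_sum (t := Finset.univ)
    (w := fun _ => 1 / (Fintype.card ι : ℝ)) (p := a)
    (fun i _ => (div_pos one_pos hN).le)
    (by rw [Finset.sum_const, Finset.card_univ, nsmul_eq_mul]; field_simp)
    (fun i _ => Set.mem_Ioi.2 (ha i))
  simp only [smul_eq_mul] at h
  have e1 : ∑ i, 1 / (Fintype.card ι : ℝ) * a i = (∑ i, a i) / Fintype.card ι := by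
    rw [← Finset.mul_sum]; ring
  have e2 : ∑ i, 1 / (Fintype.card ι : ℝ) * Real.log (a i) = (∑ i, Real.log (a i)) / Fintype.card ι := by
    rw [← Finset.mul_sum]; ring
  rw [e1, e2] at h
  exact h

section General

variable {X : Type*} [MeasurableSpace X] {μ : Measure X} {w q : X → ℝ}
  {ι : Type*} [Fintype ι] [Nonempty ι] {t : ι → X ≃ᵐ X}

/-! ## §1 Reverse KL (the training loss) -/

/-- **THE REVERSE KL NEVER INCREASES UNDER AVERAGING**: `t_i` measure-preserving, `w ∘ t_i = w`,
`w, q̃ > 0` measurable, `q̃ ∈ L¹`; `q̃ log(q̃/w) ∈ L¹ ⇒ q̄ log(q̄/w) ∈ L¹` and `∫ q̄ log(q̄/w) ≤ ∫ q̃ log(q̃/w)`. -/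
theorem groupAvg_reverseKL_le (ht : ∀ i, MeasurePreserving (t i) μ μ) (hw0 : ∀ x, 0 < w x)
    (hwm : Measurable w) (hwi : Integrable w μ) (hw : ∀ i x, w (t i x) = w x) (hq0 : ∀ x, 0 < q x)
    (hqm : Measurable q) (hqi : Integrable q μ)
    (hKL : Integrable (fun x => q x * Real.log (q x / w x)) μ) :
    Integrable (fun x => (∑ i, q (t i x)) / Fintype.card ι
      * Real.log ((∑ i, q (t i x)) / Fintype.card ι / w x)) μ ∧
    ∫ x, (∑ i, q (t i x)) / Fintype.card ι * Real.log ((∑ i, q (t i x)) / Fintype.card ι / w x) ∂μ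
      ≤ ∫ x, q x * Real.log (q x / w x) ∂μ := by
  have hN : (0 : ℝ) < Fintype.card ι := by exact_mod_cast Fintype.card_pos
  set F : X → ℝ := fun x => q x * Real.log (q x / w x) with hF
  have hFi : ∀ i, Integrable (fun x => F (t i x)) μ := fun i => integrable_comp_symmetry ht i hKL
  have hF_eq : ∀ i x, F (t i x) = q (t i x) * Real.log (q (t i x) / w x) := fun i x => by
    show q (t i x) * Real.log (q (t i x) / w (t i x)) = q (t i x) * Real.log (q (t i x) / w x)
    rw [hw i x]
  have hint_i : ∀ i, ∫ x, F (t i x) ∂μ = ∫ x, F x ∂μ := fun i => integral_comp_symmetry ht i F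
  have hqi' : ∀ i, Integrable (fun x => q (t i x)) μ := fun i => integrable_comp_symmetry ht i hqi
  have hs0 : ∀ x, 0 < (∑ i, q (t i x)) / Fintype.card ι := fun x =>
    div_pos (Finset.sum_pos (fun i _ => hq0 _) Finset.univ_nonempty) hN
  -- pointwise bounds
  have hup : ∀ x, (∑ i, q (t i x)) / Fintype.card ι * Real.log ((∑ i, q (t i x)) / Fintype.card ι / w x)
      ≤ (∑ i, F (t i x)) / Fintype.card ι := fun x => by
    have h := avg_mul_log_div_le (a := fun i => q (t i x)) (fun i => hq0 _) (hw0 x)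
    simp only [hF_eq]
    exact h
  have sub_le : ∀ {a b : ℝ}, 0 < a → 0 < b → a - b ≤ a * Real.log (a / b) := fun {a b} ha hb => by
    have h := Real.one_sub_inv_le_log_of_pos (div_pos ha hb)
    have e : a * (1 - (a / b)⁻¹) = a - b := by field_simp
    calc a - b = a * (1 - (a / b)⁻¹) := e.symm
      _ ≤ a * Real.log (a / b) := mul_le_mul_of_nonneg_left h ha.le
  have hlo : ∀ x, (∑ i, q (t i x)) / Fintype.card ι - w x
      ≤ (∑ i, q (t i x)) / Fintype.card ι * Real.log ((∑ i, q (t i x)) / Fintype.card ι / w x) :=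
    fun x => sub_le (hs0 x) (hw0 x)
  have hmeas : Measurable fun x => (∑ i, q (t i x)) / Fintype.card ι
      * Real.log ((∑ i, q (t i x)) / Fintype.card ι / w x) := by
    have hm : Measurable fun x => (∑ i, q (t i x)) / (Fintype.card ι : ℝ) :=
      (Finset.measurable_sum _ fun i _ => hqm.comp (t i).measurable).div_const _
    exact hm.mul (Real.measurable_log.comp (hm.div hwm))
  have hU : Integrable (fun x => (∑ i, F (t i x)) / Fintype.card ι) μ :=
    (integrable_finsetSum Finset.univ fun i _ => hFi i).div_const _
  have hL : Integrable (fun x => (∑ i, q (t i x)) / Fintype.card ι - w x) μ :=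
    ((integrable_finsetSum Finset.univ fun i _ => hqi' i).div_const _).sub hwi
  have hint : Integrable (fun x => (∑ i, q (t i x)) / Fintype.card ι
      * Real.log ((∑ i, q (t i x)) / Fintype.card ι / w x)) μ := by
    refine Integrable.mono' (hU.abs.add hL.abs) hmeas.aestronglyMeasurable
      (Eventually.of_forall fun x => ?_)
    rw [Real.norm_eq_abs]
    have h1 := hup x
    have h2 := hlo x
    rcases le_or_gt 0 ((∑ i, q (t i x)) / Fintype.card ι
        * Real.log ((∑ i, q (t i x)) / Fintype.card ι / w x)) with h | h
    · rw [abs_of_nonneg h]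
      exact h1.trans ((le_abs_self _).trans (le_add_of_nonneg_right (abs_nonneg _)))
    · rw [abs_of_neg h]
      have : -((∑ i, q (t i x)) / Fintype.card ι
          * Real.log ((∑ i, q (t i x)) / Fintype.card ι / w x))
          ≤ |(∑ i, q (t i x)) / Fintype.card ι - w x| := by
        have := neg_abs_le ((∑ i, q (t i x)) / Fintype.card ι - w x)
        linarith
      exact this.trans (le_add_of_nonneg_left (abs_nonneg _))
  refine ⟨hint, ?_⟩
  calc ∫ x, (∑ i, q (t i x)) / Fintype.card ι
        * Real.log ((∑ i, q (t i x)) / Fintype.card ι / w x) ∂μ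
      ≤ ∫ x, (∑ i, F (t i x)) / Fintype.card ι ∂μ := integral_mono hint hU hup
    _ = ∫ x, F x ∂μ := by
        rw [integral_div, integral_finsetSum Finset.univ fun i _ => hFi i]
        simp only [hint_i, Finset.sum_const, Finset.card_univ, nsmul_eq_mul]
        field_simp

/-! ## §2 Forward KL (the coverage loss) -/

/-- **THE FORWARD KL NEVER INCREASES UNDER AVERAGING**: `w log(w/q̃) ∈ L¹ ⇒ w log(w/q̄) ∈ L¹` and
`∫ w log(w/q̄) ≤ ∫ w log(w/q̃)` (`log q̄ ≥ N⁻¹ Σ log q̃∘t_i` pointwise). -/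
theorem groupAvg_forwardKL_le (ht : ∀ i, MeasurePreserving (t i) μ μ) (hw0 : ∀ x, 0 < w x)
    (hwm : Measurable w) (hwi : Integrable w μ) (hw : ∀ i x, w (t i x) = w x) (hq0 : ∀ x, 0 < q x)
    (hqm : Measurable q) (hqi : Integrable q μ)
    (hKL : Integrable (fun x => w x * Real.log (w x / q x)) μ) :
    Integrable (fun x => w x * Real.log (w x / ((∑ i, q (t i x)) / Fintype.card ι))) μ ∧
    ∫ x, w x * Real.log (w x / ((∑ i, q (t i x)) / Fintype.card ι)) ∂μ
      ≤ ∫ x, w x * Real.log (w x / q x) ∂μ := by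
  have hN : (0 : ℝ) < Fintype.card ι := by exact_mod_cast Fintype.card_pos
  set F : X → ℝ := fun x => w x * Real.log (w x / q x) with hF
  have hFi : ∀ i, Integrable (fun x => F (t i x)) μ := fun i => integrable_comp_symmetry ht i hKL
  have hF_eq : ∀ i x, F (t i x) = w x * Real.log (w x / q (t i x)) := fun i x => by
    show w (t i x) * Real.log (w (t i x) / q (t i x)) = w x * Real.log (w x / q (t i x))
    rw [hw i x]
  have hint_i : ∀ i, ∫ x, F (t i x) ∂μ = ∫ x, F x ∂μ := fun i => integral_comp_symmetry ht i F
  have hqi' : ∀ i, Integrable (fun x => q (t i x)) μ := fun i => integrable_comp_symmetry ht i hqi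
  have hs0 : ∀ x, 0 < (∑ i, q (t i x)) / Fintype.card ι := fun x =>
    div_pos (Finset.sum_pos (fun i _ => hq0 _) Finset.univ_nonempty) hN
  have hup : ∀ x, w x * Real.log (w x / ((∑ i, q (t i x)) / Fintype.card ι))
      ≤ (∑ i, F (t i x)) / Fintype.card ι := fun x => by
    have h := avg_log_le_log_avg (a := fun i => q (t i x)) fun i => hq0 _
    simp only [hF_eq]
    rw [Real.log_div (hw0 x).ne' (hs0 x).ne']
    have e : (∑ i, w x * Real.log (w x / q (t i x))) / Fintype.card ι
        = w x * Real.log (w x) - w x * ((∑ i, Real.log (q (t i x))) / Fintype.card ι) := by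
      have : ∀ i, w x * Real.log (w x / q (t i x)) = w x * Real.log (w x) - w x * Real.log (q (t i x)) :=
        fun i => by rw [Real.log_div (hw0 x).ne' (hq0 _).ne']; ring
      simp only [this, Finset.sum_sub_distrib, Finset.sum_const, Finset.card_univ, nsmul_eq_mul,
        ← Finset.mul_sum]
      field_simp
    rw [e]
    nlinarith [hw0 x, h]
  have sub_le : ∀ {a b : ℝ}, 0 < a → 0 < b → a - b ≤ a * Real.log (a / b) := fun {a b} ha hb => by
    have h := Real.one_sub_inv_le_log_of_pos (div_pos ha hb)
    have e : a * (1 - (a / b)⁻¹) = a - b := by field_simp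
    calc a - b = a * (1 - (a / b)⁻¹) := e.symm
      _ ≤ a * Real.log (a / b) := mul_le_mul_of_nonneg_left h ha.le
  have hlo : ∀ x, w x - (∑ i, q (t i x)) / Fintype.card ι
      ≤ w x * Real.log (w x / ((∑ i, q (t i x)) / Fintype.card ι)) := fun x => sub_le (hw0 x) (hs0 x)
  have hmeas : Measurable fun x => w x * Real.log (w x / ((∑ i, q (t i x)) / Fintype.card ι)) :=
    hwm.mul (Real.measurable_log.comp (hwm.div
      ((Finset.measurable_sum _ fun i _ => hqm.comp (t i).measurable).div_const _)))
  have hU : Integrable (fun x => (∑ i, F (t i x)) / Fintype.card ι) μ :=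
    (integrable_finsetSum Finset.univ fun i _ => hFi i).div_const _
  have hL : Integrable (fun x => w x - (∑ i, q (t i x)) / Fintype.card ι) μ :=
    hwi.sub ((integrable_finsetSum Finset.univ fun i _ => hqi' i).div_const _)
  have hint : Integrable (fun x => w x * Real.log (w x / ((∑ i, q (t i x)) / Fintype.card ι))) μ := by
    refine Integrable.mono' (hU.abs.add hL.abs) hmeas.aestronglyMeasurable
      (Eventually.of_forall fun x => ?_)
    rw [Real.norm_eq_abs]
    have h1 := hup x
    have h2 := hlo x
    rcases le_or_gt 0 (w x * Real.log (w x / ((∑ i, q (t i x)) / Fintype.card ι))) with h | h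
    · rw [abs_of_nonneg h]
      exact h1.trans ((le_abs_self _).trans (le_add_of_nonneg_right (abs_nonneg _)))
    · rw [abs_of_neg h]
      have : -(w x * Real.log (w x / ((∑ i, q (t i x)) / Fintype.card ι)))
          ≤ |w x - (∑ i, q (t i x)) / Fintype.card ι| := by
        have := neg_abs_le (w x - (∑ i, q (t i x)) / Fintype.card ι)
        linarith
      exact this.trans (le_add_of_nonneg_left (abs_nonneg _))
  refine ⟨hint, ?_⟩
  calc ∫ x, w x * Real.log (w x / ((∑ i, q (t i x)) / Fintype.card ι)) ∂μ
      ≤ ∫ x, (∑ i, F (t i x)) / Fintype.card ι ∂μ := integral_mono hint hU hup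
    _ = ∫ x, F x ∂μ := by
        rw [integral_div, integral_finsetSum Finset.univ fun i _ => hFi i]
        simp only [hint_i, Finset.sum_const, Finset.card_univ, nsmul_eq_mul]
        field_simp

/-! ## §3 Overlap (total variation) -/

/-- **THE OVERLAP NEVER DECREASES UNDER AVERAGING**: `∫ min(w, q̃) ≤ ∫ min(w, q̄)`. -/
theorem groupAvg_overlap_ge (ht : ∀ i, MeasurePreserving (t i) μ μ) (hw0 : ∀ x, 0 < w x)
    (hwm : Measurable w) (hw : ∀ i x, w (t i x) = w x) (hq0 : ∀ x, 0 < q x) (hqm : Measurable q)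
    (hqi : Integrable q μ) :
    ∫ x, min (w x) (q x) ∂μ ≤ ∫ x, min (w x) ((∑ i, q (t i x)) / Fintype.card ι) ∂μ := by
  have hN : (0 : ℝ) < Fintype.card ι := by exact_mod_cast Fintype.card_pos
  have hqi' : ∀ i, Integrable (fun x => q (t i x)) μ := fun i => integrable_comp_symmetry ht i hqi
  have hmin : ∀ {f : X → ℝ}, (∀ x, 0 < f x) → Measurable f → Integrable f μ →
      Integrable (fun x => min (w x) (f x)) μ := fun hf0 hfm hfi => by
    refine Integrable.mono' hfi (hwm.min hfm).aestronglyMeasurable (Eventually.of_forall fun x => ?_)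
    rw [Real.norm_eq_abs, abs_of_nonneg (le_min (hw0 x).le (hf0 x).le)]
    exact min_le_right _ _
  have hIi : ∀ i, Integrable (fun x => min (w x) (q (t i x))) μ := fun i =>
    hmin (fun x => hq0 _) (hqm.comp (t i).measurable) (hqi' i)
  have hIs : Integrable (fun x => min (w x) ((∑ i, q (t i x)) / Fintype.card ι)) μ :=
    hmin (fun x => div_pos (Finset.sum_pos (fun i _ => hq0 _) Finset.univ_nonempty) hN)
      ((Finset.measurable_sum _ fun i _ => hqm.comp (t i).measurable).div_const _)
      ((integrable_finsetSum Finset.univ fun i _ => hqi' i).div_const _)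
  have hint_i : ∀ i, ∫ x, min (w x) (q (t i x)) ∂μ = ∫ x, min (w x) (q x) ∂μ := fun i => by
    rw [← integral_comp_symmetry ht i (fun x => min (w x) (q x))]
    exact integral_congr_ae (Eventually.of_forall fun x => by simp only [hw i])
  have hpt : ∀ x, (∑ i, min (w x) (q (t i x))) / Fintype.card ι
      ≤ min (w x) ((∑ i, q (t i x)) / Fintype.card ι) := fun x => by
    have h := Literature.Probability.MarkovChains.sum_min_le_min_sum Finset.univ
      (fun _ => w x) (fun i => q (t i x))
    have e : min (w x) ((∑ i, q (t i x)) / Fintype.card ι)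
        = min (∑ _i : ι, w x) (∑ i, q (t i x)) / Fintype.card ι := by
      rw [← min_div_div_right hN.le, Finset.sum_const, Finset.card_univ, nsmul_eq_mul]
      congr 1
      field_simp
    rw [e]
    exact div_le_div_of_nonneg_right h hN.le
  calc ∫ x, min (w x) (q x) ∂μ = (∑ i, ∫ x, min (w x) (q (t i x)) ∂μ) / Fintype.card ι := by
        simp only [hint_i, Finset.sum_const, Finset.card_univ, nsmul_eq_mul]
        field_simp
    _ = ∫ x, (∑ i, min (w x) (q (t i x))) / Fintype.card ι ∂μ := by
        rw [integral_div, integral_finsetSum Finset.univ fun i _ => hIi i]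
    _ ≤ ∫ x, min (w x) ((∑ i, q (t i x)) / Fintype.card ι) ∂μ :=
        integral_mono ((integrable_finsetSum Finset.univ fun i _ => hIi i).div_const _) hIs hpt

end General

end Summit.Ventures.LatticeQCDFlow.Exactness
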